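import Summits.ValiantsHypothesis.ValiantsHypothesis.Theorems.FermionicJetQuadraticDcCdetKernel

/-!
# Route `FermionicJet`, crux `QuadraticDcCdet` (stmt-ValiantsHypothesis-5343) — helper 5b:
# the pattern matrix has trivial kernel (`n ≥ 5`)

Continuation of helper 5a (`patternKernel_aggregates`): once the ten invariant aggregates of `v`
vanish, for every `j ∈ γ` the seven `j`-indexed quantities `v(p,j), v(q,j), v(j,p), v(j,q),
v(j,j)`, `Σ_i v(j,i)`, `Σ_i v(i,j)` satisfy a `7 × 7` homogeneous system of determinant
`-8(n-4)⁴(n⁴-12n³+51n²-86n+39) ≠ 0`, hence vanish; finally `2v(j,i) - 4v(i,j) = 0 = 2v(i,j) - 4v(j,i)`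
kills the off-diagonal `R × R` entries: `patternMulVec_eq_zero_imp`.  Certificates (polynomial
multipliers in `k`, computed exactly) are checked by `ring`.
HONEST FRAMING: a quadratic `dc` lower bound for a dormant route's polynomial; nothing here bears on
`VP ≠ VNP`, which is NOT proved.
-/

noncomputable section

open Finset

-- layout Summits/ValiantsHypothesis/ValiantsHypothesis forces the duplicated namespace component
set_option linter.dupNamespace false

namespace Summit.ValiantsHypothesis.ValiantsHypothesis.Theorems.FermionicJet.CdetHessian

/-- Splitting one term out of a sum (left-oriented condition). -/
theorem sum_ite_eq_diag_left {K : Type*} [CommRing K] {γ : Type*} [Fintype γ] [DecidableEq γ]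
    (j : γ) (A B : γ → K) :
    (∑ i, if j = i then A i else B i) = A j + (∑ i, B i) - B j := by
  have h : ∀ i, (if j = i then A i else B i) = B i + (if i = j then A j - B j else 0) := by
    intro i
    by_cases hji : j = i
    · subst hji; simp
    · rw [if_neg hji, if_neg (Ne.symm hji), add_zero]
  simp_rw [h]
  simp only [Finset.sum_add_distrib, Finset.sum_ite_eq', Finset.mem_univ, if_true]
  ring

/-- Splitting one term out of a sum (right-oriented condition). -/
theorem sum_ite_eq_diag_right {K : Type*} [CommRing K] {γ : Type*} [Fintype γ] [DecidableEq γ]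
    (j : γ) (A B : γ → K) :
    (∑ i, if i = j then A i else B i) = A j + (∑ i, B i) - B j := by
  have h : ∀ i, (if i = j then A i else B i) = B i + (if i = j then A j - B j else 0) := by
    intro i
    by_cases hij : i = j
    · subst hij; simp
    · rw [if_neg hij, if_neg hij, add_zero]
  simp_rw [h]
  simp only [Finset.sum_add_distrib, Finset.sum_ite_eq', Finset.mem_univ, if_true]
  ring

set_option maxHeartbeats 4000000 in
/-- **The pattern matrix has trivial kernel** (`n = k + 5 ≥ 5`): if the closed form of `M *ᵥ v`
(helper 4, `patternMulVec_apply`, with `p = none`, `q = some none`, `α = -(k+1)`, `β = k+3`)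
vanishes identically, then `v = 0`. -/
theorem patternMulVec_eq_zero_imp {K : Type*} [Field K] [CharZero K] {γ : Type*} [Fintype γ]
    [DecidableEq γ] (k : ℕ) (hγ : Fintype.card γ = k + 3)
    (v : Option (Option γ) × Option (Option γ) → K)
    (hcf : ∀ c d : Option (Option γ),
      ((-((k : K) + 1)) * (if c = d then
          2 * (∑ a, v (a, a)) - 3 * v (c, c) - ((∑ x, v x) - (∑ b, v (c, b)) - ∑ a, v (a, c))
        else
          ((∑ x, v x) - (∑ b, v (c, b)) - (∑ a, v (a, d)) + v (c, d))
            - 2 * ((∑ a, v (a, a)) - v (c, c) - v (d, d)) - 2 * v (d, c)) +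
      ((k : K) + 3) * (if d = some none ∨ c = none then 0 else
        if (if c = some none then none else c) = d then
          2 * ((∑ a, v (a, if a = some none then none else a)) - v (none, none)) - 2 * v (c, d)
            - ((∑ x, v x) - (∑ b, v (c, b)) - (∑ b, v (none, b)) - (∑ a, v (a, d))
                - (∑ a, v (a, some none)) + v (c, d) + v (c, some none) + v (none, d)
                + v (none, some none))
        else
          ((∑ x, v x) - (∑ b, v (c, b)) - (∑ b, v (none, b)) - (∑ a, v (a, d))
              - (∑ a, v (a, some none)) + v (c, d) + v (c, some none) + v (none, d)
              + v (none, some none))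
            - 2 * ((∑ a, v (a, if a = some none then none else a)) - v (none, none)
                - v (c, if c = some none then none else c)
                - v ((if d = none then some none else d), d))
            - 2 * v ((if d = none then some none else d), (if c = some none then none else c)))) = 0) :
    v = 0 := by
  have hcm : (∑ j : γ, ∑ i : γ, v (some (some i), some (some j))) =
      ∑ i : γ, ∑ j : γ, v (some (some i), some (some j)) := Finset.sum_comm
  obtain ⟨hz1, hz2, hz3, hz4, hz5, hz6, hz7, hz8, hz9, hz10⟩ := patternKernel_aggregates k hγ v hcf
  have hsz : ∀ j : γ, v (none, some (some j)) = 0 ∧ v (some none, some (some j)) = 0 ∧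
      v (some (some j), none) = 0 ∧ v (some (some j), some none) = 0 ∧
      v (some (some j), some (some j)) = 0 ∧ (∑ i, v (some (some j), some (some i))) = 0 ∧
      (∑ i, v (some (some i), some (some j))) = 0 := by
    intro j
    have es1 : ((1 : K) + (1 : K) * (k : K)) * v (some none, some (some j)) + ((2 : K)
        + (2 : K) * (k : K)) * v (some (some j), none) + ((-2 : K)
        + (-2 : K) * (k : K)) * v (some (some j), some (some j)) + ((1 : K)
        + (1 : K) * (k : K)) * (∑ i, v (some (some i), some (some j))) = 0 := by
      have h := hcf none (some (some j))
      simp only [Fintype.sum_option, Fintype.sum_prod_type, if_true, if_false, reduceCtorEq,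
        Option.some.injEq, or_true, Finset.sum_add_distrib, mul_zero, add_zero] at h
      linear_combination h - ((1 : K) + (1 : K) * (k : K)) * hz2 - ((-1 : K)
          + (-1 : K) * (k : K)) * hz4 - ((-1 : K) + (-1 : K) * (k : K)) * hz6 - ((-1 : K)
          + (-1 : K) * (k : K)) * hz7 - ((-1 : K) + (-1 : K) * (k : K)) * hz8 - ((2 : K)
          + (2 : K) * (k : K)) * hz9 - ((-1 : K) + (-1 : K) * (k : K)) * hz10
    have es2 : ((1 : K) + (1 : K) * (k : K)) * v (none, some (some j)) + ((-6 : K)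
        + (-2 : K) * (k : K)) * v (some (some j), none) + ((2 : K)
        + (2 : K) * (k : K)) * v (some (some j), some none)
        + ((4 : K)) * v (some (some j), some (some j))
        + ((-2 : K)) * (∑ i, v (some (some i), some (some j))) = 0 := by
      have h := hcf (some none) (some (some j))
      simp only [Fintype.sum_option, Fintype.sum_prod_type, if_true, if_false, reduceCtorEq,
        Option.some.injEq, or_false, Finset.sum_add_distrib] at h
      linear_combination h - ((1 : K) + (1 : K) * (k : K)) * hz1 - ((-1 : K)
          + (-1 : K) * (k : K)) * hz3 - ((-1 : K) + (-1 : K) * (k : K)) * hz5 - ((2 : K)) * hz7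
          - ((-1 : K) + (-1 : K) * (k : K)) * hz8 - ((-4 : K)) * hz9 - ((2 : K)) * hz10
    have es3 : ((2 : K) + (2 : K) * (k : K)) * v (none, some (some j)) + ((-6 : K)
        + (-2 : K) * (k : K)) * v (some none, some (some j)) + ((1 : K)
        + (1 : K) * (k : K)) * v (some (some j), some none)
        + ((4 : K)) * v (some (some j), some (some j))
        + ((-2 : K)) * (∑ i, v (some (some j), some (some i))) = 0 := by
      have h := hcf (some (some j)) none
      simp only [Fintype.sum_option, Fintype.sum_prod_type, if_true, if_false, reduceCtorEq,
        Option.some.injEq, or_false, Finset.sum_add_distrib] at h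
      linear_combination h - ((1 : K) + (1 : K) * (k : K)) * hz2 - ((-1 : K)
          + (-1 : K) * (k : K)) * hz3 - ((-1 : K) + (-1 : K) * (k : K)) * hz5 - ((2 : K)) * hz6
          - ((-1 : K) + (-1 : K) * (k : K)) * hz8 - ((-4 : K)) * hz9 - ((2 : K)) * hz10
    have es4 : ((2 : K) + (2 : K) * (k : K)) * v (some none, some (some j)) + ((1 : K)
        + (1 : K) * (k : K)) * v (some (some j), none) + ((-2 : K)
        + (-2 : K) * (k : K)) * v (some (some j), some (some j)) + ((1 : K)
        + (1 : K) * (k : K)) * (∑ i, v (some (some j), some (some i))) = 0 := by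
      have h := hcf (some (some j)) (some none)
      simp only [Fintype.sum_option, Fintype.sum_prod_type, if_true, if_false, reduceCtorEq,
        Option.some.injEq, or_false, Finset.sum_add_distrib, mul_zero, add_zero] at h
      linear_combination h - ((1 : K) + (1 : K) * (k : K)) * hz1 - ((-1 : K)
          + (-1 : K) * (k : K)) * hz4 - ((-1 : K) + (-1 : K) * (k : K)) * hz5 - ((-1 : K)
          + (-1 : K) * (k : K)) * hz6 - ((-1 : K) + (-1 : K) * (k : K)) * hz7 - ((2 : K)
          + (2 : K) * (k : K)) * hz9 - ((-1 : K) + (-1 : K) * (k : K)) * hz10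
    have es5 : ((-1 : K) + (-1 : K) * (k : K)) * v (none, some (some j))
        + ((2 : K)) * v (some none, some (some j)) + ((2 : K)) * v (some (some j), none)
        + ((-1 : K) + (-1 : K) * (k : K)) * v (some (some j), some none)
        + ((-6 : K)) * v (some (some j), some (some j))
        + ((2 : K)) * (∑ i, v (some (some j), some (some i)))
        + ((2 : K)) * (∑ i, v (some (some i), some (some j))) = 0 := by
      have h := hcf (some (some j)) (some (some j))
      simp only [Fintype.sum_option, Fintype.sum_prod_type, if_true, if_false, reduceCtorEq,
        Option.some.injEq, or_false, Finset.sum_add_distrib] at h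
      linear_combination h - ((-1 : K) + (-1 : K) * (k : K)) * hz1 - ((-1 : K)
          + (-1 : K) * (k : K)) * hz2 - ((1 : K) + (1 : K) * (k : K)) * hz3 - ((4 : K)
          + (2 : K) * (k : K)) * hz4 - ((1 : K) + (1 : K) * (k : K)) * hz5 - ((-2 : K)) * hz6
          - ((-2 : K)) * hz7 - ((1 : K) + (1 : K) * (k : K)) * hz8 - ((4 : K)) * hz9
          - ((-2 : K)) * hz10
    have es6 : ((-2 : K) + (-2 : K) * (k : K)) * v (none, some (some j))
        + ((4 : K)) * v (some none, some (some j)) + ((-2 : K)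
        + (-2 : K) * (k : K)) * v (some (some j), none) + ((1 : K) + (2 : K) * (k : K)
        + (1 : K) * (k : K) ^ 2) * v (some (some j), some none)
        + ((4 : K) * (k : K)) * v (some (some j), some (some j))
        + ((-2 : K) * (k : K)) * (∑ i, v (some (some j), some (some i))) = 0 := by
      have h := Finset.sum_eq_zero (fun (i : γ) (_ : i ∈ Finset.univ) => hcf (some (some j)) (some (some i)))
      simp only [Fintype.sum_option, Fintype.sum_prod_type, if_true, if_false, reduceCtorEq,
        Option.some.injEq, or_false, ← Finset.mul_sum, Finset.sum_add_distrib] at h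
      rw [sum_ite_eq_diag_left, sum_ite_eq_diag_left] at h
      simp only [← Finset.mul_sum, Finset.sum_add_distrib, Finset.sum_sub_distrib,
        Finset.sum_const, Finset.card_univ, hγ, nsmul_eq_mul, Nat.cast_add, Nat.cast_ofNat, hcm] at h
      linear_combination h - ((1 : K) + (2 : K) * (k : K) + (1 : K) * (k : K) ^ 2) * hz1
          - ((1 : K) + (2 : K) * (k : K) + (1 : K) * (k : K) ^ 2) * hz2 - ((-1 : K)
          + (-2 : K) * (k : K) + (-1 : K) * (k : K) ^ 2) * hz3 - ((-4 : K) + (-6 : K) * (k : K)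
          + (-2 : K) * (k : K) ^ 2) * hz4 - ((-1 : K) * (k : K) + (-1 : K) * (k : K) ^ 2) * hz5
          - ((2 : K) * (k : K)) * hz6 - ((2 : K) + (2 : K) * (k : K)) * hz7 - ((-1 : K)
          + (-2 : K) * (k : K) + (-1 : K) * (k : K) ^ 2) * hz8 - ((-4 : K) * (k : K)) * hz9
          - ((2 : K) * (k : K)) * hz10
    have es7 : ((1 : K) + (2 : K) * (k : K) + (1 : K) * (k : K) ^ 2) * v (none, some (some j))
        + ((-2 : K) + (-2 : K) * (k : K)) * v (some none, some (some j))
        + ((4 : K)) * v (some (some j), none) + ((-2 : K)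
        + (-2 : K) * (k : K)) * v (some (some j), some none)
        + ((4 : K) * (k : K)) * v (some (some j), some (some j))
        + ((-2 : K) * (k : K)) * (∑ i, v (some (some i), some (some j))) = 0 := by
      have h := Finset.sum_eq_zero (fun (i : γ) (_ : i ∈ Finset.univ) => hcf (some (some i)) (some (some j)))
      simp only [Fintype.sum_option, Fintype.sum_prod_type, if_true, if_false, reduceCtorEq,
        Option.some.injEq, or_false, ← Finset.mul_sum, Finset.sum_add_distrib] at h
      rw [sum_ite_eq_diag_right, sum_ite_eq_diag_right] at h
      simp only [← Finset.mul_sum, Finset.sum_add_distrib, Finset.sum_sub_distrib,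
        Finset.sum_const, Finset.card_univ, hγ, nsmul_eq_mul, Nat.cast_add, Nat.cast_ofNat] at h
      linear_combination h - ((1 : K) + (2 : K) * (k : K) + (1 : K) * (k : K) ^ 2) * hz1
          - ((1 : K) + (2 : K) * (k : K) + (1 : K) * (k : K) ^ 2) * hz2 - ((-1 : K)
          + (-2 : K) * (k : K) + (-1 : K) * (k : K) ^ 2) * hz3 - ((-4 : K) + (-6 : K) * (k : K)
          + (-2 : K) * (k : K) ^ 2) * hz4 - ((-1 : K) + (-2 : K) * (k : K)
          + (-1 : K) * (k : K) ^ 2) * hz5 - ((2 : K) + (2 : K) * (k : K)) * hz6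
          - ((2 : K) * (k : K)) * hz7 - ((-1 : K) * (k : K) + (-1 : K) * (k : K) ^ 2) * hz8
          - ((-4 : K) * (k : K)) * hz9 - ((2 : K) * (k : K)) * hz10
    have hQ1 : ((9 : K) + (33 : K) * (k : K) + (45 : K) * (k : K) ^ 2 + (29 : K) * (k : K) ^ 3
        + (9 : K) * (k : K) ^ 4 + (1 : K) * (k : K) ^ 5) ≠ 0 := by
      rw [show ((9 : K) + (33 : K) * (k : K) + (45 : K) * (k : K) ^ 2 + (29 : K) * (k : K) ^ 3
          + (9 : K) * (k : K) ^ 4 + (1 : K) * (k : K) ^ 5) = ((9 + 33 * k + 45 * k ^ 2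
          + 29 * k ^ 3 + 9 * k ^ 4
          + 1 * k ^ 5 : ℕ) : K) by push_cast; ring, Nat.cast_ne_zero]; omega
    have hQ2 : ((18 : K) + (66 : K) * (k : K) + (90 : K) * (k : K) ^ 2 + (58 : K) * (k : K) ^ 3
        + (18 : K) * (k : K) ^ 4 + (2 : K) * (k : K) ^ 5) ≠ 0 := by
      rw [show ((18 : K) + (66 : K) * (k : K) + (90 : K) * (k : K) ^ 2 + (58 : K) * (k : K) ^ 3
          + (18 : K) * (k : K) ^ 4 + (2 : K) * (k : K) ^ 5) = ((18 + 66 * k + 90 * k ^ 2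
          + 58 * k ^ 3 + 18 * k ^ 4
          + 2 * k ^ 5 : ℕ) : K) by push_cast; ring, Nat.cast_ne_zero]; omega
    have hQ3 : ((6 : K) + (16 : K) * (k : K) + (12 : K) * (k : K) ^ 2
        + (2 : K) * (k : K) ^ 3) ≠ 0 := by
      rw [show ((6 : K) + (16 : K) * (k : K) + (12 : K) * (k : K) ^ 2
          + (2 : K) * (k : K) ^ 3) = ((6 + 16 * k + 12 * k ^ 2
          + 2 * k ^ 3 : ℕ) : K) by push_cast; ring, Nat.cast_ne_zero]; omega
    have hsz1 : v (none, some (some j)) = 0 := (mul_eq_zero.mp (show ((9 : K) + (33 : K) * (k : K)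
        + (45 : K) * (k : K) ^ 2 + (29 : K) * (k : K) ^ 3 + (9 : K) * (k : K) ^ 4
        + (1 : K) * (k : K) ^ 5) * v (none, some (some j)) = 0 by
      linear_combination ((12 : K) + (24 : K) * (k : K) + (12 : K) * (k : K) ^ 2
          + (2 : K) * (k : K) ^ 3) * es1 + ((6 : K) + (15 : K) * (k : K) + (10 : K) * (k : K) ^ 2
          + (2 : K) * (k : K) ^ 3) * es2 + ((-3 : K) + (-6 : K) * (k : K)
          + (-3 : K) * (k : K) ^ 2) * es3 + ((-6 : K) + (-12 : K) * (k : K)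
          + (-4 : K) * (k : K) ^ 2) * es4 + ((-3 : K) + (-5 : K) * (k : K)
          + (-2 : K) * (k : K) ^ 2) * es6 + ((3 : K) + (8 : K) * (k : K) + (5 : K) * (k : K) ^ 2
          + (1 : K) * (k : K) ^ 3) * es7)).resolve_left hQ1
    have hsz2 : v (some none, some (some j)) = 0 := (mul_eq_zero.mp (show ((18 : K)
        + (66 : K) * (k : K) + (90 : K) * (k : K) ^ 2 + (58 : K) * (k : K) ^ 3
        + (18 : K) * (k : K) ^ 4 + (2 : K) * (k : K) ^ 5) * v (some none, some (some j)) = 0 by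
      linear_combination ((12 : K) + (30 : K) * (k : K) + (20 : K) * (k : K) ^ 2
          + (4 : K) * (k : K) ^ 3) * es1 + ((6 : K) + (15 : K) * (k : K) + (12 : K) * (k : K) ^ 2
          + (3 : K) * (k : K) ^ 3) * es2 + ((-3 : K) + (-12 : K) * (k : K)
          + (-14 : K) * (k : K) ^ 2 + (-6 : K) * (k : K) ^ 3 + (-1 : K) * (k : K) ^ 4) * es3
          + ((-6 : K) + (-12 : K) * (k : K) + (-6 : K) * (k : K) ^ 2) * es4 + ((3 : K)
          + (5 : K) * (k : K) + (3 : K) * (k : K) ^ 2 + (1 : K) * (k : K) ^ 3) * es6 + ((6 : K)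
          + (13 : K) * (k : K) + (9 : K) * (k : K) ^ 2
          + (2 : K) * (k : K) ^ 3) * es7)).resolve_left hQ2
    have hsz3 : v (some (some j), none) = 0 := (mul_eq_zero.mp (show ((18 : K)
        + (66 : K) * (k : K) + (90 : K) * (k : K) ^ 2 + (58 : K) * (k : K) ^ 3
        + (18 : K) * (k : K) ^ 4 + (2 : K) * (k : K) ^ 5) * v (some (some j), none) = 0 by
      linear_combination ((-6 : K) + (-12 : K) * (k : K) + (-6 : K) * (k : K) ^ 2) * es1
          + ((-3 : K) + (-12 : K) * (k : K) + (-14 : K) * (k : K) ^ 2 + (-6 : K) * (k : K) ^ 3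
          + (-1 : K) * (k : K) ^ 4) * es2 + ((6 : K) + (15 : K) * (k : K) + (12 : K) * (k : K) ^ 2
          + (3 : K) * (k : K) ^ 3) * es3 + ((12 : K) + (30 : K) * (k : K) + (20 : K) * (k : K) ^ 2
          + (4 : K) * (k : K) ^ 3) * es4 + ((6 : K) + (13 : K) * (k : K) + (9 : K) * (k : K) ^ 2
          + (2 : K) * (k : K) ^ 3) * es6 + ((3 : K) + (5 : K) * (k : K) + (3 : K) * (k : K) ^ 2
          + (1 : K) * (k : K) ^ 3) * es7)).resolve_left hQ2
    have hsz4 : v (some (some j), some none) = 0 := (mul_eq_zero.mp (show ((9 : K)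
        + (33 : K) * (k : K) + (45 : K) * (k : K) ^ 2 + (29 : K) * (k : K) ^ 3
        + (9 : K) * (k : K) ^ 4 + (1 : K) * (k : K) ^ 5) * v (some (some j), some none) = 0 by
      linear_combination ((-6 : K) + (-12 : K) * (k : K) + (-4 : K) * (k : K) ^ 2) * es1
          + ((-3 : K) + (-6 : K) * (k : K) + (-3 : K) * (k : K) ^ 2) * es2 + ((6 : K)
          + (15 : K) * (k : K) + (10 : K) * (k : K) ^ 2 + (2 : K) * (k : K) ^ 3) * es3 + ((12 : K)
          + (24 : K) * (k : K) + (12 : K) * (k : K) ^ 2 + (2 : K) * (k : K) ^ 3) * es4 + ((3 : K)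
          + (8 : K) * (k : K) + (5 : K) * (k : K) ^ 2 + (1 : K) * (k : K) ^ 3) * es6 + ((-3 : K)
          + (-5 : K) * (k : K) + (-2 : K) * (k : K) ^ 2) * es7)).resolve_left hQ1
    have hsz5 : v (some (some j), some (some j)) = 0 := (mul_eq_zero.mp (show ((6 : K)
        + (16 : K) * (k : K) + (12 : K) * (k : K) ^ 2
        + (2 : K) * (k : K) ^ 3) * v (some (some j), some (some j)) = 0 by
      linear_combination ((2 : K) * (k : K)) * es1 + ((3 : K) + (3 : K) * (k : K)) * es2
          + ((3 : K) + (3 : K) * (k : K)) * es3 + ((2 : K) * (k : K)) * es4 + ((3 : K)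
          + (8 : K) * (k : K) + (6 : K) * (k : K) ^ 2 + (1 : K) * (k : K) ^ 3) * es5 + ((6 : K)
          + (7 : K) * (k : K) + (1 : K) * (k : K) ^ 2) * es6 + ((6 : K) + (7 : K) * (k : K)
          + (1 : K) * (k : K) ^ 2) * es7)).resolve_left hQ3
    have hsz6 : (∑ i, v (some (some j), some (some i))) = 0 := (mul_eq_zero.mp (show ((18 : K)
        + (66 : K) * (k : K) + (90 : K) * (k : K) ^ 2 + (58 : K) * (k : K) ^ 3
        + (18 : K) * (k : K) ^ 4
        + (2 : K) * (k : K) ^ 5) * (∑ i, v (some (some j), some (some i))) = 0 by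
      linear_combination ((-18 : K) + (-36 : K) * (k : K) + (-22 : K) * (k : K) ^ 2
          + (-4 : K) * (k : K) ^ 3) * es1 + ((9 : K) + (18 : K) * (k : K) + (14 : K) * (k : K) ^ 2
          + (6 : K) * (k : K) ^ 3 + (1 : K) * (k : K) ^ 4) * es2 + ((18 : K) + (45 : K) * (k : K)
          + (40 : K) * (k : K) ^ 2 + (15 : K) * (k : K) ^ 3 + (2 : K) * (k : K) ^ 4) * es3
          + ((18 : K) + (54 : K) * (k : K) + (46 : K) * (k : K) ^ 2 + (16 : K) * (k : K) ^ 3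
          + (2 : K) * (k : K) ^ 4) * es4 + ((18 : K) + (66 : K) * (k : K) + (90 : K) * (k : K) ^ 2
          + (58 : K) * (k : K) ^ 3 + (18 : K) * (k : K) ^ 4 + (2 : K) * (k : K) ^ 5) * es5
          + ((24 : K) + (55 : K) * (k : K) + (45 : K) * (k : K) ^ 2 + (16 : K) * (k : K) ^ 3
          + (2 : K) * (k : K) ^ 4) * es6 + ((21 : K) + (47 : K) * (k : K) + (39 : K) * (k : K) ^ 2
          + (15 : K) * (k : K) ^ 3 + (2 : K) * (k : K) ^ 4) * es7)).resolve_left hQ2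
    have hsz7 : (∑ i, v (some (some i), some (some j))) = 0 := (mul_eq_zero.mp (show ((18 : K)
        + (66 : K) * (k : K) + (90 : K) * (k : K) ^ 2 + (58 : K) * (k : K) ^ 3
        + (18 : K) * (k : K) ^ 4
        + (2 : K) * (k : K) ^ 5) * (∑ i, v (some (some i), some (some j))) = 0 by
      linear_combination ((18 : K) + (54 : K) * (k : K) + (46 : K) * (k : K) ^ 2
          + (16 : K) * (k : K) ^ 3 + (2 : K) * (k : K) ^ 4) * es1 + ((18 : K) + (45 : K) * (k : K)
          + (40 : K) * (k : K) ^ 2 + (15 : K) * (k : K) ^ 3 + (2 : K) * (k : K) ^ 4) * es2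
          + ((9 : K) + (18 : K) * (k : K) + (14 : K) * (k : K) ^ 2 + (6 : K) * (k : K) ^ 3
          + (1 : K) * (k : K) ^ 4) * es3 + ((-18 : K) + (-36 : K) * (k : K)
          + (-22 : K) * (k : K) ^ 2 + (-4 : K) * (k : K) ^ 3) * es4 + ((18 : K)
          + (66 : K) * (k : K) + (90 : K) * (k : K) ^ 2 + (58 : K) * (k : K) ^ 3
          + (18 : K) * (k : K) ^ 4 + (2 : K) * (k : K) ^ 5) * es5 + ((21 : K) + (47 : K) * (k : K)
          + (39 : K) * (k : K) ^ 2 + (15 : K) * (k : K) ^ 3 + (2 : K) * (k : K) ^ 4) * es6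
          + ((24 : K) + (55 : K) * (k : K) + (45 : K) * (k : K) ^ 2 + (16 : K) * (k : K) ^ 3
          + (2 : K) * (k : K) ^ 4) * es7)).resolve_left hQ2
    exact ⟨hsz1, hsz2, hsz3, hsz4, hsz5, hsz6, hsz7⟩
  have hloc : ∀ j i : γ, j ≠ i →
      (2 : K) * v (some (some j), some (some i))
          + (-4 : K) * v (some (some i), some (some j)) = 0 := by
    intro j i hji
    have hij : i ≠ j := Ne.symm hji
    have h := hcf (some (some j)) (some (some i))
    simp only [hji, Fintype.sum_option, Fintype.sum_prod_type, if_true, if_false, reduceCtorEq,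
      Option.some.injEq, or_false, Finset.sum_add_distrib] at h
    linear_combination h - ((-2 : K)) * (hsz j).2.2.1 - ((1 : K)
        + (1 : K) * (k : K)) * (hsz j).2.2.2.1 - ((4 : K)) * (hsz j).2.2.2.2.1
        - ((-2 : K)) * (hsz j).2.2.2.2.2.1 - ((1 : K) + (1 : K) * (k : K)) * (hsz i).1
        - ((-2 : K)) * (hsz i).2.1 - ((4 : K)) * (hsz i).2.2.2.2.1
        - ((-2 : K)) * (hsz i).2.2.2.2.2.2 - ((1 : K) + (1 : K) * (k : K)) * hz1 - ((1 : K)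
        + (1 : K) * (k : K)) * hz2 - ((-1 : K) + (-1 : K) * (k : K)) * hz3 - ((-4 : K)
        + (-2 : K) * (k : K)) * hz4 - ((-1 : K) + (-1 : K) * (k : K)) * hz5 - ((2 : K)) * hz6
        - ((2 : K)) * hz7 - ((-1 : K) + (-1 : K) * (k : K)) * hz8 - ((-4 : K)) * hz9
        - ((2 : K)) * hz10
  funext x
  rw [Pi.zero_apply]
  obtain ⟨a, b⟩ := x
  rcases a with _ | _ | ja <;> rcases b with _ | _ | jb
  · exact hz1
  · exact hz3
  · exact (hsz jb).1
  · exact hz4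
  · exact hz2
  · exact (hsz jb).2.1
  · exact (hsz ja).2.2.1
  · exact (hsz ja).2.2.2.1
  · by_cases hj : ja = jb
    · subst hj; exact (hsz ja).2.2.2.2.1
    · have h1 := hloc ja jb hj
      have h2 := hloc jb ja (Ne.symm hj)
      have h3 : (6 : K) * v (some (some ja), some (some jb)) = 0 := by linear_combination (-1 : K) * h1
          + (-2 : K) * h2
      exact (mul_eq_zero.mp h3).resolve_left (by norm_num)

end Summit.ValiantsHypothesis.ValiantsHypothesis.Theorems.FermionicJet.CdetHessian
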